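import Mathlib
import Summits.Ventures.PercRepro2.SwGlue2
import Summits.Ventures.PercRepro2.SwAllGlue
import Summits.Ventures.PercRepro2.SwEar
import Summits.Ventures.PercRepro2.SwAllReduce

/-!
# The residual class of row 2′SW-ALL, sharpened by the `{l, h}`-bridge reduction
(blind cell PercRepro2, night-4 g6, 2026-08-24; proofs/NIGHT4-G6.md §9)

A two-vertex cut `{l, h}` of the graph (`HasCut2`: the sides cover `V`, meet exactly in `l, h`, every
edge lies inside a side, each side carries a private edge) is a gluing `Glue2.IsGluing2` of the two
edge-subtypes (`HasCut2.isGluing2`), and the glued graph is the original one relabelled by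
`Equiv.sumCompl` (`glue2_sides_eq`).  With g5's rigid bridge lemma `Glue2.swAll_glue2` the induction of
`SwAllReduce.lean` also reduces across such a cut when `o` lies on the first side, and with g5's ear
composition `Ear.swAll_ear` across a two-vertex cut `{u, v}` with all three marks on the first side
and at least two edges on the other (`HasEar`).  `SwAllResidual2` adds «no `{l, h}`-cut with `o` on one
side and a private edge on the other» (`HasBridge`) and «no 2-cut with the marks on one side and two
edges on the other» (`HasEar`) to `SwAllResidual`; `swAll_all_of_residual2 : SwAllResidual2 → SwAll_all`,
`sw_all_of_residual2 : SwAllResidual2 → Sw_all`.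
-/

namespace Summit.Ventures.PercRepro2

namespace Glue

open Hull LocRows

open scoped Classical

variable {V : Type*}

/-! ## Two-vertex cuts as gluings -/

section Cut2

variable {E : Type*} (ends : E → Sym2 V)

/-- `{l, h}` is a two-vertex cut with sides `V₁`, `V₂`: the sides cover `V` and meet exactly in `l`
and `h`, every edge lies inside a side, and each side carries an edge not inside the other. -/
structure HasCut2 (l h : V) (V₁ V₂ : Set V) : Prop where
  /-- `l` lies on both sides. -/
  l_mem₁ : l ∈ V₁
  /-- `l` lies on both sides. -/
  l_mem₂ : l ∈ V₂
  /-- `h` lies on both sides. -/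
  h_mem₁ : h ∈ V₁
  /-- `h` lies on both sides. -/
  h_mem₂ : h ∈ V₂
  /-- The sides meet only in `l` and `h`. -/
  inter : ∀ x, x ∈ V₁ → x ∈ V₂ → x = l ∨ x = h
  /-- The sides cover the vertices. -/
  cover : ∀ x, x ∈ V₁ ∨ x ∈ V₂
  /-- Every edge lies inside a side. -/
  side : ∀ e, (∀ x ∈ ends e, x ∈ V₁) ∨ (∀ x ∈ ends e, x ∈ V₂)
  /-- The first side carries an edge not inside the second. -/
  edge₁ : ∃ e, ¬ ∀ x ∈ ends e, x ∈ V₂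
  /-- The second side carries an edge not inside the first. -/
  edge₂ : ∃ e, ¬ ∀ x ∈ ends e, x ∈ V₁

/-- A two-vertex cut gives a gluing at `{l, h}` of the two edge-subtypes. -/
lemma HasCut2.isGluing2 {l h : V} {V₁ V₂ : Set V} (hc : HasCut2 ends l h V₁ V₂) :
    Glue2.IsGluing2 (ends₁ ends V₁) (ends₂ ends V₁) l h V₁ V₂ := by
  refine ⟨hc.l_mem₁, hc.l_mem₂, hc.h_mem₁, hc.h_mem₂, hc.inter, fun e x hx => e.2 x hx,
    fun e x hx => ?_⟩
  rcases hc.side e.1 with h | h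
  · exact absurd h e.2
  · exact h x hx

/-- The glued graph of the two sides is the original graph, relabelled by `Equiv.sumCompl`. -/
lemma glue2_sides_eq (V₁ : Set V) :
    Glue2.glue2 (ends₁ ends V₁) (ends₂ ends V₁) =
      ends ∘ (Equiv.sumCompl fun e => ∀ x ∈ ends e, x ∈ V₁) := by
  funext e
  rcases e with e | e <;> rfl

/-- A `{l, h}`-cut with `o` on the first side. -/
def HasBridge (l h o : V) : Prop := ∃ V₁ V₂ : Set V, HasCut2 ends l h V₁ V₂ ∧ o ∈ V₁

variable [Fintype E] [DecidableEq E]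

/-- An ear: a two-vertex cut `{u, v}` with the three marks on the first side (and distinct from `v`)
and at least two edges on the second side. -/
def HasEar (l h o : V) : Prop :=
  ∃ (u v : V) (V₁ V₂ : Set V), u ≠ v ∧ HasCut2 ends u v V₁ V₂ ∧ l ∈ V₁ ∧ h ∈ V₁ ∧ o ∈ V₁ ∧
    l ≠ v ∧ h ≠ v ∧ o ≠ v ∧
    ∃ e e' : E, e ≠ e' ∧ ¬ (∀ x ∈ ends e, x ∈ V₁) ∧ ¬ (∀ x ∈ ends e', x ∈ V₁)

omit [DecidableEq E] in
/-- The edges split into the two sides of a cut. -/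
lemma card_sides (V₁ : Set V) :
    Fintype.card (sideE₁ ends V₁) + Fintype.card (sideE₂ ends V₁) = Fintype.card E := by
  rw [Fintype.card_subtype_compl, Nat.add_sub_cancel' (Fintype.card_subtype_le _)]

end Cut2

/-- **The residual class of row 2′SW-ALL, sharpened**: the rigid row on the multigraphs without a
cut vertex, without parallel edges, without a non-mark vertex of degree two, without a `{l, h}`-cut
separating `o` from a private edge of the other side, and without an ear (a 2-cut with the three
marks on one side and two edges on the other). -/
def SwAllResidual2 : Prop :=
  ∀ (V E : Type) [Fintype V] [DecidableEq V] [Fintype E] [DecidableEq E] (ends : E → Sym2 V),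
    (¬ ∃ (c : V) (V₁ V₂ : Set V), HasCut ends c V₁ V₂) → ¬ HasParallel ends →
      ∀ l h o : V, l ≠ h → o ≠ l → o ≠ h → ¬ HasDeg2 ends l h o → ¬ HasBridge ends l h o →
        ¬ HasEar ends l h o → SwAll ends l h o

/-- **The reduction to the sharpened residual class**: one strong induction on the number of edges
through the block, parallel, series, `{l, h}`-bridge and ear reductions. -/
theorem swAll_all_of_residual2 (hres : SwAllResidual2) : SwAll_all := by
  suffices key : ∀ n : ℕ, ∀ (V E : Type) [Fintype V] [DecidableEq V] [Fintype E] [DecidableEq E]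
      (ends : E → Sym2 V), Fintype.card E = n →
        ∀ l h o : V, l ≠ h → o ≠ l → o ≠ h → SwAll ends l h o by
    intro V E _ _ _ _ ends l h o hlh hol hoh
    exact key _ V E ends rfl l h o hlh hol hoh
  intro n
  induction n using Nat.strong_induction_on with
  | _ n ih =>
    intro V E _ _ _ _ ends hn l h o hlh hol hoh
    have ih' : ∀ (E' : Type) [Fintype E'] [DecidableEq E'] (ends' : E' → Sym2 V),
        Fintype.card E' < n → ∀ l h o : V, SwAll ends' l h o := by
      intro E' _ _ ends' hlt l h o
      exact swAll_all_marks (ih _ hlt V E' ends' rfl) l h o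
    by_cases hcut : ∃ (c : V) (V₁ V₂ : Set V), HasCut ends c V₁ V₂
    · obtain ⟨c, V₁, V₂, hc⟩ := hcut
      have h₁ : Fintype.card (sideE₁ ends V₁) < n := by
        rw [← hn]
        obtain ⟨e, he⟩ := hc.edge₂
        exact Fintype.card_subtype_lt (x := e) he
      have h₂ : Fintype.card (sideE₂ ends V₁) < n := by
        rw [← hn]
        obtain ⟨e, he⟩ := hc.edge₁
        have he' : ∀ x ∈ ends e, x ∈ V₁ := by
          rcases hc.side e with h | h
          · exact h
          · exact absurd h he
        exact Fintype.card_subtype_lt (x := e) (not_not.2 he')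
      have hs₁ : ∀ l h o : V, l ≠ h → o ≠ l → o ≠ h → SwAll (ends₁ ends V₁) l h o :=
        fun l h o _ _ _ => ih' _ (ends₁ ends V₁) h₁ l h o
      have hs₂ : ∀ l h o : V, l ≠ h → o ≠ l → o ≠ h → SwAll (ends₂ ends V₁) l h o :=
        fun l h o _ _ _ => ih' _ (ends₂ ends V₁) h₂ l h o
      have hglue := swAll_glue_of_sides hc.isGluing hs₁ hs₂ hlh hol hoh (hc.cover l) (hc.cover h)
        (hc.cover o)
      rw [glue_sides_eq] at hglue
      exact swAll_of_equiv ends _ hglue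
    by_cases hpar : HasParallel ends
    · obtain ⟨u, v, e, e', hp⟩ := hpar
      have hdel : Fintype.card (Parallel.DelE e') < n := by rw [← hn]; exact card_delE_lt e'
      have hmer : Fintype.card (Parallel.MergeE e e') < n := by
        rw [← hn]; have := card_mergeE_add_two_le hp.ne; omega
      exact Parallel.swAll_parallel hp (ih' _ _ hdel l h o) (ih' _ _ hmer _ _ _)
    by_cases hdeg : HasDeg2 ends l h o
    · obtain ⟨w, u, v, e₁, e₂, hd, hwl, hwh, hwo⟩ := hdeg
      have hdel : Fintype.card (Series.DelE e₁ e₂) < n := by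
        rw [← hn]; have := card_seriesDelE_add_two_le hd.ne; omega
      have hcon : Fintype.card (Series.DelE e₁ e₂ ⊕ Unit) < n := by
        rw [← hn, Fintype.card_sum, Fintype.card_unit]
        have := card_seriesDelE_add_two_le hd.ne; omega
      exact Series.swAll_series hd (Ne.symm hwl) (Ne.symm hwh) (Ne.symm hwo)
        (ih' _ _ hdel l h o) (ih' _ _ hcon l h o)
    by_cases hbr : HasBridge ends l h o
    · -- a `{l, h}`-cut with `o` on the first side: the rigid bridge lemma
      obtain ⟨V₁, V₂, hc, ho⟩ := hbr
      have h₁ : Fintype.card (sideE₁ ends V₁) < n := by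
        rw [← hn]
        obtain ⟨e, he⟩ := hc.edge₂
        exact Fintype.card_subtype_lt (x := e) he
      have hglue := Glue2.swAll_glue2 hc.isGluing2 ho hol hoh (ih' _ (ends₁ ends V₁) h₁ l h o)
      rw [glue2_sides_eq] at hglue
      exact swAll_of_equiv ends _ hglue
    by_cases hear : HasEar ends l h o
    · -- an ear: the one-sided 2-cut composition
      obtain ⟨u, v, V₁, V₂, huv, hc, hl, hh, ho, hlv, hhv, hov, e, e', hne, he, he'⟩ := hear
      have hsides : Fintype.card (sideE₁ ends V₁) + Fintype.card (sideE₂ ends V₁) =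
          Fintype.card E := by
        rw [Fintype.card_subtype_compl, Nat.add_sub_cancel' (Fintype.card_subtype_le _)]
      have h2 : 2 ≤ Fintype.card (sideE₂ ends V₁) := by
        have hne' : (⟨e, he⟩ : sideE₂ ends V₁) ≠ ⟨e', he'⟩ := fun h => hne (congrArg Subtype.val h)
        calc 2 = ({(⟨e, he⟩ : sideE₂ ends V₁), ⟨e', he'⟩} : Finset (sideE₂ ends V₁)).card :=
              (Finset.card_pair hne').symm
          _ ≤ (Finset.univ : Finset (sideE₂ ends V₁)).card :=
              Finset.card_le_card (Finset.subset_univ _)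
          _ = Fintype.card (sideE₂ ends V₁) := Finset.card_univ
      have h₁ : Fintype.card (sideE₁ ends V₁) < n := by rw [← hn]; omega
      have h₁' : Fintype.card (sideE₁ ends V₁ ⊕ Unit) < n := by
        rw [← hn, Fintype.card_sum, Fintype.card_unit]; omega
      have hglue := Ear.swAll_ear hc.isGluing2 huv hl hh ho hlv hhv hov
        (ih' _ (ends₁ ends V₁) h₁ l h o) (ih' _ (Ear.addEnds (ends₁ ends V₁) u v) h₁' l h o)
        (ih' _ (Ear.mergeEnds (ends₁ ends V₁) u v) h₁ l h o)
      rw [glue2_sides_eq] at hglue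
      exact swAll_of_equiv ends _ hglue
    · exact hres V E ends hcut hpar l h o hlh hol hoh hdeg hbr hear

/-- **The weight-free base through the sharpened residual class.** -/
theorem sw_all_of_residual2 (hres : SwAllResidual2) : Sw_all :=
  sw_all_of_swAll_all (swAll_all_of_residual2 hres)

end Glue

end Summit.Ventures.PercRepro2
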